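import Mathlib.Geometry.Euclidean.Inversion.Calculus
import Mathlib.Analysis.InnerProductSpace.PiL2
import Mathlib.Analysis.InnerProductSpace.Calculus
import Mathlib.Analysis.Calculus.ContDiff.WithLp
import Mathlib.LinearAlgebra.FiniteDimensional.Lemmas
import Literature.Algebra.EuclideanLattices.FccBccLattices
import HarnessLib

/-!
# Crux `BlockLipschitzL` (stmt-QuantumFields-23533) ∕ `HistoryTailL` (stmt-QuantumFields-19936), LINE 25 «CompactnessTransfer»,
# the (GAP)∕(TM) road (H) «SU(2) currents ⇒ H-system ⇒ 8π quantum», brick (T) «CONE → PLANE TRANSPORT» —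
# FILE A1 «THE CONE LINK CHART: INVERSE STEREOGRAPHIC PROJECTION AND ITS CONFORMAL FRAME»

Cell `ym3-torus` (YM ladder rung R3 = continuum SU(2) Yang–Mills on T³ — a RUNG, NOT Clay: not d = 4, not infinite volume,
not a mass gap); WIDTH helper seat `ym3-torus-px16` g10, typing px14 g7's SPEC `SPEC-ConeLinkChart.px14g7.lean` (architect
of brick (T)) for px19 g8's ROAD (H); `--supports stmt-QuantumFields-23533`; THEOREMS ONLY (0 `def`, 0 `sorry`, default
heartbeats); imports Mathlib + lit ✓`Literature.Algebra.EuclideanLattices.FccBccLattices` (the coordinate letters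
`inner_fin_three`, `norm_sq_fin_three` of `ℝ³`; its parent `GaussLattice3D` supplies FILE A3's Gram determinant).

THE OBJECTS (def-free; the symbols are PINNED BY HYPOTHESES and discharged by `fun _ => rfl` at the consumer's door, so no
symbol leaks into brick (T)'s conclusions):
* `c : E² → ℝ`, `hc : ∀ y, c y = 2 / (1 + ‖y‖ ^ 2)` — the conformal factor of inverse stereographic projection;
* `σ : E² → E³`, `hσ : ∀ y, σ y = !₂[c y * y 0, c y * y 1, c y - 1]` — inverse stereographic projection `ℝ² → S² ⊂ ℝ³`
  from the south pole `S = (0,0,−1)`; it is the restriction to the plane `x₂ = 0` of the INVERSION of centre `S` and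
  radius `√2` (★ `sigma_eq_inversion`), which is how conformality is proved without one coordinate derivative: Mathlib's
  `EuclideanGeometry.hasFDerivAt_inversion` gives `Dσ_y = c(y) • (reflection ∘ emb)` (★ `hasFDerivAt_sigma`).
The cone chart of brick (T) is `(t, y) ↦ t • σ y : (0,∞) × E² → E³ ∖ {south ray}`; its angular inverse `π` and region `V` are
FILE A2 (`…ConeLinkChartRegion`), its Jacobian `t² · c(y)²` and the change of variables FILE A3 (`…ConeLinkChartIntegral`).

WHAT THIS FILE PROVES. `0 < c ≤ 2`, `c ∈ C^∞`; `‖σ y‖ = 1`, `σ ∈ C^∞`, `σ` injective; ★★ CONFORMALITY `⟪Dσ u, Dσ v⟫ = c² ⟪u, v⟫`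
(`inner_fderiv_sigma`), `‖Dσ v‖ = c ‖v‖`; ★ RADIAL ORTHOGONALITY `⟪σ, Dσ v⟫ = 0` (derivative of the constant `‖σ‖² = 1`);
★★ THE FRAME IDENTITY `Σ_i ⟪a e_i, b e_i⟫ = ⟪a σ, b σ⟫ + c⁻² Σ_k ⟪a (Dσ e_k), b (Dσ e_k)⟫` for continuous linear `a, b : E³ → F`
(`sum_inner_apply_single_eq_frame`: the trace form does not depend on the orthonormal frame; the frame is
`{σ, c⁻¹Dσ e₀, c⁻¹Dσ e₁}`) — this is what turns the 3-d Dirichlet density and the 3-d sphere currents of a radially constant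
map into their 2-d counterparts on the link.

HONEST SCOPE.  Multivariable calculus of one explicit chart; nothing of (T), (Q), (H), (F), (GAP), (TM), S1″, K1,
`MeanDeviationL`, `BlockLipschitzL`, `HistoryTailL` is proved here.  YM₃ on T³ is rung R3, not Clay; YM gap NOT proved; no
summit statement is proved here.

References: H. Brezis, J.-M. Coron, Arch. Rational Mech. Anal. 89 (1985) 21–56 [BrezisCoron1985] (Appendix, Lemma A.1 —
the target of the road); R. Schoen, K. Uhlenbeck, Invent. Math. 78 (1984) 89–100 [SchoenUhlenbeck1984] (§1, tangent maps and
their links `S² → S³`).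
-/

set_option autoImplicit false

noncomputable section

open Set Function Filter Topology Metric
open scoped RealInnerProductSpace BigOperators ContDiff

namespace Summit.QuantumFields.YangMills.Theorems.PoincareLipschitzConeLinkChart

open Literature.Algebra.EuclideanLattices (inner_fin_three norm_sq_fin_three)

variable {c : EuclideanSpace ℝ (Fin 2) → ℝ} {σ : EuclideanSpace ℝ (Fin 2) → EuclideanSpace ℝ (Fin 3)}

/-! ## §0 Coordinate letters -/

/-- Coordinates of `!₂[a, b, d] : E³`. [folklore] -/
theorem vec3_apply (a b d : ℝ) :
    (!₂[a, b, d] : EuclideanSpace ℝ (Fin 3)) 0 = a ∧ (!₂[a, b, d] : EuclideanSpace ℝ (Fin 3)) 1 = b ∧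
      (!₂[a, b, d] : EuclideanSpace ℝ (Fin 3)) 2 = d := by
  refine ⟨?_, ?_, ?_⟩ <;> simp

/-- Coordinates of `!₂[a, b] : E²`. [folklore] -/
theorem vec2_apply (a b : ℝ) :
    (!₂[a, b] : EuclideanSpace ℝ (Fin 2)) 0 = a ∧ (!₂[a, b] : EuclideanSpace ℝ (Fin 2)) 1 = b := by
  refine ⟨?_, ?_⟩ <;> simp

/-- `1 + ‖y‖² = 1 + (y₀² + y₁²)` on `E²` (the denominator of the conformal factor in coordinates). [folklore] -/
theorem one_add_norm_sq (y : EuclideanSpace ℝ (Fin 2)) : 1 + ‖y‖ ^ 2 = 1 + (y 0 ^ 2 + y 1 ^ 2) := by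
  rw [EuclideanSpace.norm_sq_eq, Fin.sum_univ_two]
  simp [Real.norm_eq_abs, sq_abs]

/-- `‖σ‖²`-type letter: `‖(a, b, d)‖² = a² + b² + d²` for the explicit vector `!₂[a, b, d]`, read through
`norm_sq_fin_three`. [folklore] -/
theorem norm_sq_vec3_eq (a b d : ℝ) : ‖(!₂[a, b, d] : EuclideanSpace ℝ (Fin 3))‖ ^ 2 - (a ^ 2 + b ^ 2 + d ^ 2) = 0 := by
  rw [norm_sq_fin_three, (vec3_apply a b d).1, (vec3_apply a b d).2.1, (vec3_apply a b d).2.2, sub_self]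

/-- Coordinates of `σ y`. [folklore] -/
theorem sigma_apply (hσ : ∀ y, σ y = !₂[c y * y 0, c y * y 1, c y - 1]) (y : EuclideanSpace ℝ (Fin 2)) :
    σ y 0 = c y * y 0 ∧ σ y 1 = c y * y 1 ∧ σ y 2 = c y - 1 := by
  rw [hσ]
  exact vec3_apply _ _ _

/-- The coordinate functions of `E²` are smooth. [folklore] -/
theorem contDiff_apply_two (i : Fin 2) : ContDiff ℝ ∞ (fun y : EuclideanSpace ℝ (Fin 2) => y i) :=
  (EuclideanSpace.proj i : EuclideanSpace ℝ (Fin 2) →L[ℝ] ℝ).contDiff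

/-- The coordinate functions of `E³` are smooth. [folklore] -/
theorem contDiff_apply_three (i : Fin 3) : ContDiff ℝ ∞ (fun x : EuclideanSpace ℝ (Fin 3) => x i) :=
  (EuclideanSpace.proj i : EuclideanSpace ℝ (Fin 3) →L[ℝ] ℝ).contDiff

/-! ## §1 The conformal factor and inverse stereographic projection -/

/-- `0 < c`. [folklore] -/
theorem c_pos (hc : ∀ y, c y = 2 / (1 + ‖y‖ ^ 2)) (y : EuclideanSpace ℝ (Fin 2)) : 0 < c y := by
  rw [hc]; positivity

/-- `c ≤ 2`. [folklore] -/
theorem c_le_two (hc : ∀ y, c y = 2 / (1 + ‖y‖ ^ 2)) (y : EuclideanSpace ℝ (Fin 2)) : c y ≤ 2 := by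
  rw [hc]
  exact div_le_self zero_le_two (le_add_of_nonneg_right (sq_nonneg _))

/-- The defining identity `c · (1 + ‖y‖²) = 2`, in coordinates. [folklore] -/
theorem c_mul_eq_two (hc : ∀ y, c y = 2 / (1 + ‖y‖ ^ 2)) (y : EuclideanSpace ℝ (Fin 2)) :
    c y * (1 + (y 0 ^ 2 + y 1 ^ 2)) = 2 := by
  rw [hc, ← one_add_norm_sq]
  field_simp

/-- `c ∈ C^∞`. [folklore] -/
theorem contDiff_c (hc : ∀ y, c y = 2 / (1 + ‖y‖ ^ 2)) : ContDiff ℝ ∞ c := by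
  have h : c = fun y => 2 / (1 + ‖y‖ ^ 2) := funext hc
  rw [h]
  exact contDiff_const.div (contDiff_const.add (contDiff_norm_sq ℝ)) fun y => by positivity

/-- `‖σ y‖ = 1`: inverse stereographic projection lands on the unit sphere. [folklore] -/
theorem norm_sigma (hc : ∀ y, c y = 2 / (1 + ‖y‖ ^ 2))
    (hσ : ∀ y, σ y = !₂[c y * y 0, c y * y 1, c y - 1]) (y : EuclideanSpace ℝ (Fin 2)) : ‖σ y‖ = 1 := by
  have h2 := c_mul_eq_two hc y
  have hs : ‖σ y‖ ^ 2 = 1 ^ 2 := by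
    rw [hσ]
    linear_combination (c y) * h2 + norm_sq_vec3_eq (c y * y 0) (c y * y 1) (c y - 1)
  exact (pow_left_inj₀ (norm_nonneg _) zero_le_one two_ne_zero).1 hs

/-- `σ ∈ C^∞`. [folklore] -/
theorem contDiff_sigma (hc : ∀ y, c y = 2 / (1 + ‖y‖ ^ 2))
    (hσ : ∀ y, σ y = !₂[c y * y 0, c y * y 1, c y - 1]) : ContDiff ℝ ∞ σ := by
  have h : σ = fun y => !₂[c y * y 0, c y * y 1, c y - 1] := funext hσ
  rw [h, contDiff_euclidean]
  intro i
  fin_cases i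
  · exact (contDiff_c hc).mul (contDiff_apply_two 0)
  · exact (contDiff_c hc).mul (contDiff_apply_two 1)
  · exact (contDiff_c hc).sub contDiff_const

/-- `σ` is differentiable. [folklore] -/
theorem differentiable_sigma (hc : ∀ y, c y = 2 / (1 + ‖y‖ ^ 2))
    (hσ : ∀ y, σ y = !₂[c y * y 0, c y * y 1, c y - 1]) : Differentiable ℝ σ :=
  (contDiff_sigma hc hσ).differentiable (by simp)

/-- `σ` is injective: `c` and hence `y₀, y₁` are read off the coordinates of `σ y`. [folklore] -/
theorem sigma_injective (hc : ∀ y, c y = 2 / (1 + ‖y‖ ^ 2))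
    (hσ : ∀ y, σ y = !₂[c y * y 0, c y * y 1, c y - 1]) : Injective σ := by
  intro y y' h
  obtain ⟨a0, a1, a2⟩ := sigma_apply hσ y
  obtain ⟨b0, b1, b2⟩ := sigma_apply hσ y'
  have e0 : σ y 0 = σ y' 0 := by rw [h]
  have e1 : σ y 1 = σ y' 1 := by rw [h]
  have e2 : σ y 2 = σ y' 2 := by rw [h]
  rw [a2, b2] at e2
  have hcc : c y = c y' := by linarith
  rw [a0, b0, hcc] at e0
  rw [a1, b1, hcc] at e1
  have hc0 : c y' ≠ 0 := (c_pos hc y').ne'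
  ext i
  fin_cases i
  · exact mul_left_cancel₀ hc0 e0
  · exact mul_left_cancel₀ hc0 e1

/-- ★ **`σ` IS AN INVERSION**: `σ y = inversion_{S, √2} (y₀, y₁, 0)` with `S = −e₂` the south pole — the restriction of
the inversion of centre `S` and radius `√2` to the plane `x₂ = 0`. [folklore] -/
theorem sigma_eq_inversion (hc : ∀ y, c y = 2 / (1 + ‖y‖ ^ 2))
    (hσ : ∀ y, σ y = !₂[c y * y 0, c y * y 1, c y - 1]) (y : EuclideanSpace ℝ (Fin 2)) :
    σ y = EuclideanGeometry.inversion (-(EuclideanSpace.single 2 (1:ℝ)) : EuclideanSpace ℝ (Fin 3))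
      (Real.sqrt 2) (!₂[y 0, y 1, 0]) := by
  set S : EuclideanSpace ℝ (Fin 3) := -(EuclideanSpace.single 2 (1:ℝ)) with hS
  set x : EuclideanSpace ℝ (Fin 3) := !₂[y 0, y 1, 0] with hx
  have hxS : x - S = !₂[y 0, y 1, 1] := by
    ext i
    fin_cases i <;> simp [hx, hS]
  have hd : dist x S ^ 2 = 1 + ‖y‖ ^ 2 := by
    rw [dist_eq_norm, hxS, one_add_norm_sq]
    linear_combination norm_sq_vec3_eq (y 0) (y 1) 1
  have hcoef : (Real.sqrt 2 / dist x S) ^ 2 = c y := by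
    rw [div_pow, Real.sq_sqrt (by norm_num), hd, hc]
  rw [EuclideanGeometry.inversion, vsub_eq_sub, vadd_eq_add, hcoef, hxS, hσ]
  ext i
  fin_cases i
  · simp [hS]
  · simp [hS]
  · simp [hS]
    ring

/-- The inclusion of the plane `E² ↪ E³`, `v ↦ (v₀, v₁, 0)`, as a continuous linear map, and its values. [folklore] -/
theorem planeEmb_apply (v : EuclideanSpace ℝ (Fin 2)) :
    ((EuclideanSpace.proj (0 : Fin 2) : EuclideanSpace ℝ (Fin 2) →L[ℝ] ℝ).smulRight
        (EuclideanSpace.single (0 : Fin 3) (1:ℝ)) +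
      (EuclideanSpace.proj (1 : Fin 2) : EuclideanSpace ℝ (Fin 2) →L[ℝ] ℝ).smulRight
        (EuclideanSpace.single (1 : Fin 3) (1:ℝ))) v = (!₂[v 0, v 1, 0] : EuclideanSpace ℝ (Fin 3)) := by
  ext i
  fin_cases i <;> simp

/-- The plane inclusion preserves inner products. [folklore] -/
theorem inner_planeEmb (u v : EuclideanSpace ℝ (Fin 2)) :
    ⟪(!₂[u 0, u 1, 0] : EuclideanSpace ℝ (Fin 3)), !₂[v 0, v 1, 0]⟫ = ⟪u, v⟫ := by
  rw [inner_fin_three, (vec3_apply _ _ _).1, (vec3_apply _ _ _).2.1, (vec3_apply _ _ _).2.2,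
    (vec3_apply _ _ _).1, (vec3_apply _ _ _).2.1, (vec3_apply _ _ _).2.2, EuclideanSpace.inner_eq_star_dotProduct]
  simp [dotProduct, Fin.sum_univ_two, mul_comm]

/-- ★ **THE DERIVATIVE OF `σ`** through the inversion: `Dσ_y = c(y) • (reflection_{(ℝ∙(x−S))ᗮ} ∘ emb)` with
`x = (y₀, y₁, 0)`, `S = −e₂` (Mathlib `EuclideanGeometry.hasFDerivAt_inversion`). [folklore] -/
theorem hasFDerivAt_sigma (hc : ∀ y, c y = 2 / (1 + ‖y‖ ^ 2))
    (hσ : ∀ y, σ y = !₂[c y * y 0, c y * y 1, c y - 1]) (y : EuclideanSpace ℝ (Fin 2)) :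
    HasFDerivAt σ (c y • (((ℝ ∙ ((!₂[y 0, y 1, 0] : EuclideanSpace ℝ (Fin 3)) -
        (-(EuclideanSpace.single 2 (1:ℝ)))))ᗮ.reflection :
          EuclideanSpace ℝ (Fin 3) →L[ℝ] EuclideanSpace ℝ (Fin 3)).comp
      ((EuclideanSpace.proj (0 : Fin 2) : EuclideanSpace ℝ (Fin 2) →L[ℝ] ℝ).smulRight
          (EuclideanSpace.single (0 : Fin 3) (1:ℝ)) +
        (EuclideanSpace.proj (1 : Fin 2) : EuclideanSpace ℝ (Fin 2) →L[ℝ] ℝ).smulRight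
          (EuclideanSpace.single (1 : Fin 3) (1:ℝ))))) y := by
  set S : EuclideanSpace ℝ (Fin 3) := -(EuclideanSpace.single 2 (1:ℝ)) with hS
  set emb : EuclideanSpace ℝ (Fin 2) →L[ℝ] EuclideanSpace ℝ (Fin 3) :=
    (EuclideanSpace.proj (0 : Fin 2) : EuclideanSpace ℝ (Fin 2) →L[ℝ] ℝ).smulRight
        (EuclideanSpace.single (0 : Fin 3) (1:ℝ)) +
      (EuclideanSpace.proj (1 : Fin 2) : EuclideanSpace ℝ (Fin 2) →L[ℝ] ℝ).smulRight
        (EuclideanSpace.single (1 : Fin 3) (1:ℝ)) with hemb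
  have hembv : ∀ v, emb v = !₂[v 0, v 1, 0] := fun v => planeEmb_apply v
  have hσ' : σ = fun y => EuclideanGeometry.inversion S (Real.sqrt 2) (emb y) := by
    funext y'
    rw [sigma_eq_inversion hc hσ, hembv]
  have hne : emb y ≠ S := by
    intro h
    have h2 := congrArg (fun v : EuclideanSpace ℝ (Fin 3) => v 2) h
    rw [hembv] at h2
    simp [hS] at h2
  have hd : dist (emb y) S ^ 2 = 1 + ‖y‖ ^ 2 := by
    have hxS : emb y - S = !₂[y 0, y 1, 1] := by
      rw [hembv]
      ext i
      fin_cases i <;> simp [hS]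
    rw [dist_eq_norm, hxS, one_add_norm_sq]
    linear_combination norm_sq_vec3_eq (y 0) (y 1) 1
  have hcoef : (Real.sqrt 2 / dist (emb y) S) ^ 2 = c y := by
    rw [div_pow, Real.sq_sqrt (by norm_num), hd, hc]
  have h := (EuclideanGeometry.hasFDerivAt_inversion (R := Real.sqrt 2) hne).comp y emb.hasFDerivAt
  rw [hcoef, ContinuousLinearMap.smul_comp, hembv y] at h
  rw [hσ']
  exact h

/-- ★★ **CONFORMALITY**: `⟪Dσ u, Dσ v⟫ = c² ⟪u, v⟫` — the reflection is a linear isometry and the plane inclusion preserves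
inner products. [folklore] -/
theorem inner_fderiv_sigma (hc : ∀ y, c y = 2 / (1 + ‖y‖ ^ 2))
    (hσ : ∀ y, σ y = !₂[c y * y 0, c y * y 1, c y - 1]) (y u v : EuclideanSpace ℝ (Fin 2)) :
    ⟪fderiv ℝ σ y u, fderiv ℝ σ y v⟫ = c y ^ 2 * ⟪u, v⟫ := by
  rw [(hasFDerivAt_sigma hc hσ y).fderiv]
  simp only [_root_.smul_apply, ContinuousLinearMap.comp_apply, planeEmb_apply,
    real_inner_smul_left, real_inner_smul_right]
  rw [ContinuousLinearEquiv.coe_coe, LinearIsometryEquiv.coe_toContinuousLinearEquiv,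
    LinearIsometryEquiv.inner_map_map, inner_planeEmb]
  ring

/-- `‖Dσ v‖ = c ‖v‖`. [folklore] -/
theorem norm_fderiv_sigma (hc : ∀ y, c y = 2 / (1 + ‖y‖ ^ 2))
    (hσ : ∀ y, σ y = !₂[c y * y 0, c y * y 1, c y - 1]) (y v : EuclideanSpace ℝ (Fin 2)) :
    ‖fderiv ℝ σ y v‖ = c y * ‖v‖ := by
  have h : ‖fderiv ℝ σ y v‖ ^ 2 = (c y * ‖v‖) ^ 2 := by
    rw [← real_inner_self_eq_norm_sq, inner_fderiv_sigma hc hσ, real_inner_self_eq_norm_sq]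
    ring
  exact (pow_left_inj₀ (norm_nonneg _) (mul_nonneg (c_pos hc y).le (norm_nonneg _)) two_ne_zero).1 h

/-- ★ **RADIAL ORTHOGONALITY**: `⟪σ, Dσ v⟫ = 0` — differentiate the constant `⟪σ, σ⟫ = 1`. [folklore] -/
theorem inner_sigma_fderiv_sigma (hc : ∀ y, c y = 2 / (1 + ‖y‖ ^ 2))
    (hσ : ∀ y, σ y = !₂[c y * y 0, c y * y 1, c y - 1]) (y v : EuclideanSpace ℝ (Fin 2)) :
    ⟪σ y, fderiv ℝ σ y v⟫ = 0 := by
  have hd : HasFDerivAt σ (fderiv ℝ σ y) y := (differentiable_sigma hc hσ y).hasFDerivAt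
  have hinner := hd.inner ℝ hd
  have hconst : HasFDerivAt (fun y' => ⟪σ y', σ y'⟫) (0 : EuclideanSpace ℝ (Fin 2) →L[ℝ] ℝ) y := by
    have h1 : (fun y' => ⟪σ y', σ y'⟫) = fun _ => (1:ℝ) := by
      funext y'
      rw [real_inner_self_eq_norm_sq, norm_sigma hc hσ, one_pow]
    rw [h1]
    exact hasFDerivAt_const 1 y
  have heq := congrArg (fun L : EuclideanSpace ℝ (Fin 2) →L[ℝ] ℝ => L v) (hinner.unique hconst)
  simp only [ContinuousLinearMap.comp_apply, ContinuousLinearMap.prod_apply, fderivInnerCLM_apply,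
    _root_.zero_apply] at heq
  rw [real_inner_comm (σ y) (fderiv ℝ σ y v)] at heq
  linarith

/-- **THE TRACE FORM DOES NOT DEPEND ON THE ORTHONORMAL FRAME**: for an orthonormal basis `f` of `E³` and continuous
linear `a, b : E³ → F`, `Σ_i ⟪a e_i, b e_i⟫ = Σ_m ⟪a f_m, b f_m⟫` (expand `f_m` in the standard basis). [folklore] -/
theorem sum_inner_apply_single_eq_sum_orthonormalBasis {F : Type*} [NormedAddCommGroup F] [InnerProductSpace ℝ F]
    (f : OrthonormalBasis (Fin 3) ℝ (EuclideanSpace ℝ (Fin 3))) (a b : EuclideanSpace ℝ (Fin 3) →L[ℝ] F) :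
    ∑ i : Fin 3, ⟪a (EuclideanSpace.single i (1:ℝ)), b (EuclideanSpace.single i (1:ℝ))⟫ =
      ∑ m : Fin 3, ⟪a (f m), b (f m)⟫ := by
  -- expansion in the standard orthonormal basis
  have hstd : ∀ x : EuclideanSpace ℝ (Fin 3), ∑ i : Fin 3, ⟪x, EuclideanSpace.single i (1:ℝ)⟫ •
      EuclideanSpace.single i (1:ℝ) = x := by
    intro x
    have h := (EuclideanSpace.basisFun (Fin 3) ℝ).sum_repr' x
    simp only [EuclideanSpace.basisFun_apply] at h
    calc ∑ i : Fin 3, ⟪x, EuclideanSpace.single i (1:ℝ)⟫ • EuclideanSpace.single i (1:ℝ)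
        = ∑ i : Fin 3, ⟪EuclideanSpace.single i (1:ℝ), x⟫ • EuclideanSpace.single i (1:ℝ) :=
          Finset.sum_congr rfl fun i _ => by rw [real_inner_comm x]
      _ = x := h
  symm
  calc ∑ m : Fin 3, ⟪a (f m), b (f m)⟫
      = ∑ m : Fin 3, ⟪a (f m), b (∑ i : Fin 3, ⟪f m, EuclideanSpace.single i (1:ℝ)⟫ •
          EuclideanSpace.single i (1:ℝ))⟫ := Finset.sum_congr rfl fun m _ => by rw [hstd (f m)]
    _ = ∑ m : Fin 3, ∑ i : Fin 3, ⟪f m, EuclideanSpace.single i (1:ℝ)⟫ *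
          ⟪a (f m), b (EuclideanSpace.single i (1:ℝ))⟫ := Finset.sum_congr rfl fun m _ => by
        simp only [map_sum, map_smul, inner_sum, real_inner_smul_right]
    _ = ∑ i : Fin 3, ∑ m : Fin 3, ⟪f m, EuclideanSpace.single i (1:ℝ)⟫ *
          ⟪a (f m), b (EuclideanSpace.single i (1:ℝ))⟫ := Finset.sum_comm
    _ = ∑ i : Fin 3, ⟪a (∑ m : Fin 3, ⟪f m, EuclideanSpace.single i (1:ℝ)⟫ • f m),
          b (EuclideanSpace.single i (1:ℝ))⟫ := Finset.sum_congr rfl fun i _ => by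
        simp only [map_sum, map_smul, sum_inner, real_inner_smul_left]
    _ = ∑ i : Fin 3, ⟪a (EuclideanSpace.single i (1:ℝ)), b (EuclideanSpace.single i (1:ℝ))⟫ :=
        Finset.sum_congr rfl fun i _ => by rw [f.sum_repr']

/-- ★★ **THE FRAME IDENTITY** for bilinear pairings: for continuous linear `a, b : E³ → F` into a real inner product space,
`Σ_i ⟪a e_i, b e_i⟫ = ⟪a σ, b σ⟫ + c⁻² Σ_k ⟪a (Dσ e_k), b (Dσ e_k)⟫` — the trace form in the orthonormal frame
`{σ, c⁻¹Dσ e₀, c⁻¹Dσ e₁}` of `E³` attached to the point `σ y` of the sphere. [folklore] -/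
theorem sum_inner_apply_single_eq_frame {F : Type*} [NormedAddCommGroup F] [InnerProductSpace ℝ F]
    (hc : ∀ y, c y = 2 / (1 + ‖y‖ ^ 2))
    (hσ : ∀ y, σ y = !₂[c y * y 0, c y * y 1, c y - 1]) (y : EuclideanSpace ℝ (Fin 2))
    (a b : EuclideanSpace ℝ (Fin 3) →L[ℝ] F) :
    ∑ i : Fin 3, ⟪a (EuclideanSpace.single i (1:ℝ)), b (EuclideanSpace.single i (1:ℝ))⟫ =
      ⟪a (σ y), b (σ y)⟫ + (c y ^ 2)⁻¹ * ∑ k : Fin 2,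
        ⟪a (fderiv ℝ σ y (EuclideanSpace.single k (1:ℝ))), b (fderiv ℝ σ y (EuclideanSpace.single k (1:ℝ)))⟫ := by
  have hc0 : c y ≠ 0 := (c_pos hc y).ne'
  -- the frame
  set v : Fin 3 → EuclideanSpace ℝ (Fin 3) := ![σ y, (c y)⁻¹ • fderiv ℝ σ y (EuclideanSpace.single 0 (1:ℝ)),
    (c y)⁻¹ • fderiv ℝ σ y (EuclideanSpace.single 1 (1:ℝ))] with hv
  have hσσ : ⟪σ y, σ y⟫ = 1 := by rw [real_inner_self_eq_norm_sq, norm_sigma hc hσ, one_pow]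
  have hσd : ∀ k : Fin 2, ⟪σ y, fderiv ℝ σ y (EuclideanSpace.single k (1:ℝ))⟫ = 0 :=
    fun k => inner_sigma_fderiv_sigma hc hσ y _
  have hdσ : ∀ k : Fin 2, ⟪fderiv ℝ σ y (EuclideanSpace.single k (1:ℝ)), σ y⟫ = 0 :=
    fun k => by rw [real_inner_comm]; exact hσd k
  have hdd : ∀ k l : Fin 2, ⟪fderiv ℝ σ y (EuclideanSpace.single k (1:ℝ)), fderiv ℝ σ y (EuclideanSpace.single l (1:ℝ))⟫ =
      c y ^ 2 * if k = l then (1:ℝ) else 0 := by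
    intro k l
    rw [inner_fderiv_sigma hc hσ, EuclideanSpace.inner_single_left, PiLp.single_apply]
    simp
  have h00 := hdd 0 0
  have h01 := hdd 0 1
  have h10 := hdd 1 0
  have h11 := hdd 1 1
  simp only [if_true, mul_one, Fin.zero_eq_one_iff, OfNat.ofNat_ne_one, if_false,
    mul_zero, one_ne_zero] at h00 h01 h10 h11
  have hinv : (c y)⁻¹ * ((c y)⁻¹ * c y ^ 2) = 1 := by field_simp
  have hon : Orthonormal ℝ v := by
    rw [orthonormal_iff_ite]
    intro i j
    fin_cases i <;> fin_cases j
    · show ⟪σ y, σ y⟫ = _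
      rw [hσσ]; simp
    · show ⟪σ y, (c y)⁻¹ • fderiv ℝ σ y (EuclideanSpace.single 0 (1:ℝ))⟫ = _
      rw [real_inner_smul_right, hσd]; simp
    · show ⟪σ y, (c y)⁻¹ • fderiv ℝ σ y (EuclideanSpace.single 1 (1:ℝ))⟫ = _
      rw [real_inner_smul_right, hσd]; simp
    · show ⟪(c y)⁻¹ • fderiv ℝ σ y (EuclideanSpace.single 0 (1:ℝ)), σ y⟫ = _
      rw [real_inner_smul_left, hdσ]; simp
    · show ⟪(c y)⁻¹ • fderiv ℝ σ y (EuclideanSpace.single 0 (1:ℝ)),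
        (c y)⁻¹ • fderiv ℝ σ y (EuclideanSpace.single 0 (1:ℝ))⟫ = _
      rw [real_inner_smul_left, real_inner_smul_right, h00, hinv]; simp
    · show ⟪(c y)⁻¹ • fderiv ℝ σ y (EuclideanSpace.single 0 (1:ℝ)),
        (c y)⁻¹ • fderiv ℝ σ y (EuclideanSpace.single 1 (1:ℝ))⟫ = _
      rw [real_inner_smul_left, real_inner_smul_right, h01]; simp
    · show ⟪(c y)⁻¹ • fderiv ℝ σ y (EuclideanSpace.single 1 (1:ℝ)), σ y⟫ = _
      rw [real_inner_smul_left, hdσ]; simp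
    · show ⟪(c y)⁻¹ • fderiv ℝ σ y (EuclideanSpace.single 1 (1:ℝ)),
        (c y)⁻¹ • fderiv ℝ σ y (EuclideanSpace.single 0 (1:ℝ))⟫ = _
      rw [real_inner_smul_left, real_inner_smul_right, h10]; simp
    · show ⟪(c y)⁻¹ • fderiv ℝ σ y (EuclideanSpace.single 1 (1:ℝ)),
        (c y)⁻¹ • fderiv ℝ σ y (EuclideanSpace.single 1 (1:ℝ))⟫ = _
      rw [real_inner_smul_left, real_inner_smul_right, h11, hinv]; simp
  have hsp : ⊤ ≤ Submodule.span ℝ (Set.range v) :=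
    (hon.linearIndependent.span_eq_top_of_card_eq_finrank' (by simp)).ge
  set f : OrthonormalBasis (Fin 3) ℝ (EuclideanSpace ℝ (Fin 3)) := OrthonormalBasis.mk hon hsp with hf
  have hfv : ∀ m, f m = v m := fun m => by rw [hf, OrthonormalBasis.coe_mk]
  rw [sum_inner_apply_single_eq_sum_orthonormalBasis f a b, Fin.sum_univ_three, Fin.sum_univ_two, hfv, hfv, hfv]
  simp only [hv, Matrix.cons_val_zero, Matrix.cons_val_one, Matrix.cons_val_two, Matrix.head_cons,
    Matrix.tail_cons, map_smul, real_inner_smul_left, real_inner_smul_right]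
  field_simp
  ring

end Summit.QuantumFields.YangMills.Theorems.PoincareLipschitzConeLinkChart

end
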